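import Mathlib
import Summits.RiemannHypothesis.RiemannHypothesis.Theorems.WeilFormatCSoundness
import HarnessLib

/-!
# Format C: soundness of the DEFLATED certificate (design "C∞", finite-support core)

Route context: Fourier–Galerkin / Schur-complement certificates of Weil positivity on a window ("format C";
cell memo `run/shared/lean/pub/rh-explicit/rh-explicit-weil-10/FORMATC-DESIGN.md` §9.12; supporting
stmt-RiemannHypothesis-0098; seat rh-explicit-weil-10).

The two-level certificate (`sum_range_mul_mul_nonneg_of_certificate*`) charges the whole coupling of the block `[0, B)` to the
far modes `m ≥ B` at the rate `1/d̂_m` of a DIAGONAL far minorant.  Measured (weil-10 gen6, kit j1740xx–j1747xx): the block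
size this forces doubles per `+0.1` in the window half-width although the resolution floor is flat, because the smooth Schur
direction sees the primes average out while every diagonal minorant must charge them mode by mode.  The deflated certificate
removes `r` explicit far PROFILES `V` (columns of an `ℕ → Fin r → ℝ` table, used on `[B, P)`) from the far space: a far vector
`y` is split as `Vβ + w` with `β = Vᵀy|_{[B,P)}`, the profile part joins the block EXACTLY (augmented Gram), and only `w` is
charged at the diagonal rate — minus the part of the charge that the profiles themselves can absorb (an inverse-free rank-`r`
correction with a free data map `Λ`).  This file is the finite-support algebraic core (profiles vanish from `P` on); it is
sound for every truncation `N` exactly like the two-level theorem.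

* `sum_range_mul_mul_nonneg_of_certificate_deflated` — symmetric kernel `M`, block `B ≤ P`, profiles `V` on `[B, P)`, far
  diagonal `d̂ > 0` with its far inequality from `B`, a majorant `Uq` of the augmented coupling `Σ_{m≥B} g_m(x,β)²/d̂_m`
  (`g_m(x,β) = Σ_i M(i,m)x_i + Σ_{n∈[B,P)} M(n,m)(Vβ)_n`), a free map `Λ`, and ONE kernel inequality `hS` in `(x, β)`
  ⟹ `0 ≤ Σ_{n,m<N} y_n y_m M(n,m)` for every `N`, `y`.

Pure finite-dimensional real algebra; standard axioms; nothing Weil-specific; no RH claim.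
-/

-- `Summit.RiemannHypothesis.RiemannHypothesis.…` is the layout-mandated namespace (summit = problem name).
set_option linter.dupNamespace false

namespace Summit.RiemannHypothesis.RiemannHypothesis.Theorems.WeilFormatC

open Matrix Finset

/-- Reordering a four-fold finite sum: `(n, m, j, j') → (j, j', n, m)`. -/
theorem sum_sum_sum_sum_comm {ι₁ ι₂ κ₁ κ₂ : Type*} (s : Finset ι₁) (t : Finset ι₂) (u : Finset κ₁) (u' : Finset κ₂)
    (f : ι₁ → ι₂ → κ₁ → κ₂ → ℝ) :
    ∑ n ∈ s, ∑ m ∈ t, ∑ j ∈ u, ∑ j' ∈ u', f n m j j' = ∑ j ∈ u, ∑ j' ∈ u', ∑ n ∈ s, ∑ m ∈ t, f n m j j' := by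
  calc ∑ n ∈ s, ∑ m ∈ t, ∑ j ∈ u, ∑ j' ∈ u', f n m j j'
      = ∑ n ∈ s, ∑ j ∈ u, ∑ m ∈ t, ∑ j' ∈ u', f n m j j' := Finset.sum_congr rfl fun n _ ↦ Finset.sum_comm
    _ = ∑ j ∈ u, ∑ n ∈ s, ∑ m ∈ t, ∑ j' ∈ u', f n m j j' := Finset.sum_comm
    _ = ∑ j ∈ u, ∑ n ∈ s, ∑ j' ∈ u', ∑ m ∈ t, f n m j j' :=
        Finset.sum_congr rfl fun j _ ↦ Finset.sum_congr rfl fun n _ ↦ Finset.sum_comm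
    _ = ∑ j ∈ u, ∑ j' ∈ u', ∑ n ∈ s, ∑ m ∈ t, f n m j j' := Finset.sum_congr rfl fun j _ ↦ Finset.sum_comm

/-- **Soundness of the deflated format-C certificate (finite-support profiles), for every truncation.**  See the module
docstring.  The kernel inequality `hS` reads: augmented Gram form `−` coupling majorant `+ 2Λ·(Eβ + η) − ΛᵀAΛ ≥ 0`, with
`E = I − VᵀV`, `η_j = Σ_{m∈[B,P)} V_{mj} g_m/d̂_m`, `A_{jj'} = Σ_{m∈[B,P)} V_{mj}V_{mj'}/d̂_m` (all written out). -/
theorem sum_range_mul_mul_nonneg_of_certificate_deflated (M : ℕ → ℕ → ℝ) (hsymm : ∀ n m, M n m = M m n)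
    (B P : ℕ) (hBP : B ≤ P) {r : ℕ} (V : ℕ → Fin r → ℝ) (dhat : ℕ → ℝ)
    (hd : ∀ m, B ≤ m → 0 < dhat m)
    (hfar : ∀ (N : ℕ) (y : ℕ → ℝ),
      ∑ n ∈ Ico B N, dhat n * y n ^ 2 ≤ ∑ n ∈ Ico B N, ∑ m ∈ Ico B N, y n * M n m * y m)
    (Uq : (Fin B → ℝ) → (Fin r → ℝ) → ℝ) (Λ : (Fin B → ℝ) → (Fin r → ℝ) → Fin r → ℝ)
    (hU : ∀ (N : ℕ) (x : Fin B → ℝ) (β : Fin r → ℝ),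
      ∑ m ∈ Ico B N, (∑ i : Fin B, M i m * x i + ∑ n ∈ Ico B P, M n m * ∑ j, V n j * β j) ^ 2 / dhat m ≤ Uq x β)
    (hS : ∀ (x : Fin B → ℝ) (β : Fin r → ℝ), 0 ≤
      (∑ i : Fin B, ∑ i' : Fin B, x i * x i' * M i i')
        + 2 * (∑ i : Fin B, ∑ j : Fin r, x i * β j * ∑ m ∈ Ico B P, M i m * V m j)
        + (∑ j : Fin r, ∑ j' : Fin r, β j * β j' * ∑ n ∈ Ico B P, ∑ m ∈ Ico B P, V n j * M n m * V m j')
        - Uq x β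
        + 2 * ∑ j : Fin r, Λ x β j *
            ((β j - ∑ j' : Fin r, (∑ n ∈ Ico B P, V n j * V n j') * β j')
              + ∑ m ∈ Ico B P, V m j * (∑ i : Fin B, M i m * x i + ∑ n ∈ Ico B P, M n m * ∑ j, V n j * β j) / dhat m)
        - ∑ j : Fin r, ∑ j' : Fin r, Λ x β j * Λ x β j' * ∑ m ∈ Ico B P, V m j * V m j' / dhat m)
    (N : ℕ) (y : ℕ → ℝ) :
    0 ≤ ∑ n ∈ range N, ∑ m ∈ range N, y n * y m * M n m := by
  -- Reduce to `P ≤ N` by extending `y` by zero.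
  wlog hPN : P ≤ N generalizing N y
  · have hNP : N ≤ P := le_of_not_ge hPN
    set y' : ℕ → ℝ := fun n ↦ if n < N then y n else 0 with hy'
    have key := this P y' le_rfl
    have e : ∑ n ∈ range P, ∑ m ∈ range P, y' n * y' m * M n m
        = ∑ n ∈ range N, ∑ m ∈ range N, y n * y m * M n m := by
      have hsub : range N ⊆ range P := Finset.range_subset_range.mpr hNP
      rw [← Finset.sum_subset hsub]
      · refine Finset.sum_congr rfl fun n hn ↦ ?_
        have hn' : n < N := Finset.mem_range.mp hn
        rw [← Finset.sum_subset hsub]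
        · refine Finset.sum_congr rfl fun m hm ↦ ?_
          have hm' : m < N := Finset.mem_range.mp hm
          simp only [hy', if_pos hn', if_pos hm']
        · intro m _ hm
          have hm' : ¬ m < N := fun h ↦ hm (Finset.mem_range.mpr h)
          simp only [hy', if_neg hm', mul_zero, zero_mul]
      · intro n _ hn
        have hn' : ¬ n < N := fun h ↦ hn (Finset.mem_range.mpr h)
        refine Finset.sum_eq_zero fun m _ ↦ ?_
        simp only [hy', if_neg hn', zero_mul]
    rw [← e]
    exact key
  have hBN : B ≤ N := hBP.trans hPN
  have hsub : Ico B P ⊆ Ico B N := Finset.Ico_subset_Ico_right hPN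
  rw [sum_range_mul_mul_eq_block_add_coupling_add_far M hsymm hBN y]
  -- names
  set x : Fin B → ℝ := fun i ↦ y i with hx
  set β : Fin r → ℝ := fun j ↦ ∑ n ∈ Ico B P, V n j * y n with hβ
  set vP : ℕ → ℝ := fun n ↦ ∑ j, V n j * β j with hvP
  set v : ℕ → ℝ := fun n ↦ if n < P then vP n else 0 with hv
  set w : ℕ → ℝ := fun n ↦ y n - v n with hw
  set c : ℕ → ℝ := fun m ↦ ∑ i : Fin B, M i m * x i with hc
  set g : ℕ → ℝ := fun m ↦ c m + ∑ n ∈ Ico B P, M n m * vP n with hg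
  set F : Finset ℕ := Ico B N with hF
  -- sums of `f · v` over `F` live on `Ico B P`
  have hvsum : ∀ f : ℕ → ℝ, ∑ n ∈ F, f n * v n = ∑ n ∈ Ico B P, f n * vP n := by
    intro f
    have h1 : ∑ n ∈ F, f n * v n = ∑ n ∈ F, (if n < P then f n * vP n else 0) :=
      Finset.sum_congr rfl fun n _ ↦ by
        simp only [hv]
        split_ifs <;> simp
    rw [h1, ← Finset.sum_filter, Finset.Ico_filter_lt_of_le_right hPN]
  have hvsum' : ∀ f : ℕ → ℝ, ∑ n ∈ F, v n * f n = ∑ n ∈ Ico B P, vP n * f n := fun f ↦ by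
    have h := hvsum f
    have e1 : ∑ n ∈ F, v n * f n = ∑ n ∈ F, f n * v n := Finset.sum_congr rfl fun n _ ↦ mul_comm _ _
    have e2 : ∑ n ∈ Ico B P, vP n * f n = ∑ n ∈ Ico B P, f n * vP n :=
      Finset.sum_congr rfl fun n _ ↦ mul_comm _ _
    rw [e1, e2, h]
  -- (1) the block form
  have hblock : x ⬝ᵥ (Matrix.of fun i j : Fin B ↦ M i j) *ᵥ x = ∑ i : Fin B, ∑ i' : Fin B, x i * x i' * M i i' := by
    rw [dotProduct_mulVec_eq_sum_sum]
    exact Finset.sum_congr rfl fun i _ ↦ Finset.sum_congr rfl fun i' _ ↦ by simp only [Matrix.of_apply]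
  -- (2) the coupling splits: `Σ c_m y_m = Σ c_m v_m + Σ c_m w_m`
  have hcoup : ∑ m ∈ F, (∑ i : Fin B, M i m * y i) * y m = ∑ m ∈ Ico B P, c m * vP m + ∑ m ∈ F, c m * w m := by
    rw [← hvsum c, ← Finset.sum_add_distrib]
    exact Finset.sum_congr rfl fun m _ ↦ by simp only [hc, hx, hw]; ring
  -- (3) the far-far form splits: `yMy = vMv + 2 (Mv)·w + wMw`
  have hfarsplit : ∑ n ∈ F, ∑ m ∈ F, y n * M n m * y m
      = ∑ n ∈ Ico B P, ∑ m ∈ Ico B P, vP n * M n m * vP m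
        + 2 * ∑ m ∈ F, (∑ n ∈ Ico B P, M n m * vP n) * w m
        + ∑ n ∈ F, ∑ m ∈ F, w n * M n m * w m := by
    -- pointwise `y = v + w`
    have e1 : ∑ n ∈ F, ∑ m ∈ F, y n * M n m * y m
        = ∑ n ∈ F, ∑ m ∈ F, (v n * M n m * v m + (v n * M n m * w m + w n * M n m * v m) + w n * M n m * w m) :=
      Finset.sum_congr rfl fun n _ ↦ Finset.sum_congr rfl fun m _ ↦ by simp only [hw]; ring
    rw [e1]
    have esplit : ∑ n ∈ F, ∑ m ∈ F, (v n * M n m * v m + (v n * M n m * w m + w n * M n m * v m) + w n * M n m * w m)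
        = ∑ n ∈ F, ∑ m ∈ F, v n * M n m * v m + ∑ n ∈ F, ∑ m ∈ F, (v n * M n m * w m + w n * M n m * v m)
          + ∑ n ∈ F, ∑ m ∈ F, w n * M n m * w m := by
      rw [← Finset.sum_add_distrib, ← Finset.sum_add_distrib]
      refine Finset.sum_congr rfl fun n _ ↦ ?_
      rw [← Finset.sum_add_distrib, ← Finset.sum_add_distrib]
    rw [esplit]
    -- vv part
    have evv : ∑ n ∈ F, ∑ m ∈ F, v n * M n m * v m = ∑ n ∈ Ico B P, ∑ m ∈ Ico B P, vP n * M n m * vP m := by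
      have h1 : ∀ n, ∑ m ∈ F, v n * M n m * v m = v n * ∑ m ∈ Ico B P, M n m * vP m := fun n ↦ by
        rw [← hvsum (fun m ↦ M n m), Finset.mul_sum]
        exact Finset.sum_congr rfl fun m _ ↦ by ring
      rw [Finset.sum_congr rfl fun n _ ↦ h1 n, hvsum' (fun n ↦ ∑ m ∈ Ico B P, M n m * vP m)]
      refine Finset.sum_congr rfl fun n _ ↦ ?_
      rw [Finset.mul_sum]
      exact Finset.sum_congr rfl fun m _ ↦ by ring
    -- vw + wv parts (symmetry)
    have hB1 : ∑ n ∈ F, ∑ m ∈ F, v n * M n m * w m = ∑ m ∈ F, (∑ n ∈ Ico B P, M n m * vP n) * w m := by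
      rw [Finset.sum_comm]
      refine Finset.sum_congr rfl fun m _ ↦ ?_
      rw [← hvsum (fun n ↦ M n m), Finset.sum_mul]
      exact Finset.sum_congr rfl fun n _ ↦ by ring
    have hB2 : ∑ n ∈ F, ∑ m ∈ F, w n * M n m * v m = ∑ m ∈ F, (∑ n ∈ Ico B P, M n m * vP n) * w m := by
      refine Finset.sum_congr rfl fun n _ ↦ ?_
      rw [← hvsum (fun m ↦ M m n), Finset.sum_mul]
      refine Finset.sum_congr rfl fun m _ ↦ ?_
      rw [hsymm n m]; ring
    have evw1 : ∑ n ∈ F, ∑ m ∈ F, (v n * M n m * w m + w n * M n m * v m)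
        = ∑ n ∈ F, ∑ m ∈ F, v n * M n m * w m + ∑ n ∈ F, ∑ m ∈ F, w n * M n m * v m := by
      rw [← Finset.sum_add_distrib]
      exact Finset.sum_congr rfl fun n _ ↦ Finset.sum_add_distrib
    rw [evv, evw1, hB1, hB2]
    ring
  -- (4) the augmented Gram form equals `hS`'s first three terms
  have hcv : ∑ m ∈ Ico B P, c m * vP m = ∑ i : Fin B, ∑ j : Fin r, x i * β j * ∑ m ∈ Ico B P, M i m * V m j := by
    have e1 : ∀ m, c m * vP m = ∑ i, ∑ j, x i * β j * (M i m * V m j) := by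
      intro m
      simp only [hc, hvP]
      rw [Finset.sum_mul_sum]
      exact Finset.sum_congr rfl fun i _ ↦ Finset.sum_congr rfl fun j _ ↦ by ring
    rw [Finset.sum_congr rfl fun m _ ↦ e1 m, Finset.sum_comm]
    refine Finset.sum_congr rfl fun i _ ↦ ?_
    rw [Finset.sum_comm]
    refine Finset.sum_congr rfl fun j _ ↦ ?_
    simp only [← Finset.mul_sum]
  have hvMv : ∑ n ∈ Ico B P, ∑ m ∈ Ico B P, vP n * M n m * vP m
      = ∑ j : Fin r, ∑ j' : Fin r, β j * β j' * ∑ n ∈ Ico B P, ∑ m ∈ Ico B P, V n j * M n m * V m j' := by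
    have e1 : ∀ n m, vP n * M n m * vP m = ∑ j, ∑ j', β j * β j' * (V n j * M n m * V m j') := by
      intro n m
      simp only [hvP]
      rw [Finset.sum_mul, Finset.sum_mul_sum]
      exact Finset.sum_congr rfl fun j _ ↦ Finset.sum_congr rfl fun j' _ ↦ by ring
    have e2 : ∑ n ∈ Ico B P, ∑ m ∈ Ico B P, vP n * M n m * vP m
        = ∑ n ∈ Ico B P, ∑ m ∈ Ico B P, ∑ j, ∑ j', β j * β j' * (V n j * M n m * V m j') :=
      Finset.sum_congr rfl fun n _ ↦ Finset.sum_congr rfl fun m _ ↦ e1 n m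
    rw [e2, sum_sum_sum_sum_comm]
    refine Finset.sum_congr rfl fun j _ ↦ Finset.sum_congr rfl fun j' _ ↦ ?_
    simp only [← Finset.mul_sum]
  -- (5) the far inequality for `w`, completed squares, and the rank-`r` correction
  have hfw := hfar N w
  -- each far mode: 2 g w + d w² = d (w + g/d)² − g²/d
  have hd' : ∀ m ∈ F, 0 < dhat m := fun m hm ↦ hd m (Finset.mem_Ico.mp hm).1
  set u : ℕ → ℝ := fun m ↦ w m + g m / dhat m with hu
  have hsq : ∀ m ∈ F, 2 * g m * w m + dhat m * w m ^ 2 = dhat m * u m ^ 2 - g m ^ 2 / dhat m := by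
    intro m hm
    have hdm := (hd' m hm).ne'
    simp only [hu]
    field_simp
    ring
  -- the λ-inequality: Σ d u² ≥ 2 Σ_j λ_j Σ_m V' u − Σ λλ' Σ V'V'/d  (V' = V on [B,P), 0 beyond)
  set lam : Fin r → ℝ := Λ x β with hlam
  set Vp : ℕ → Fin r → ℝ := fun n j ↦ if n < P then V n j else 0 with hVp
  have hVpsum : ∀ f : ℕ → ℝ, ∀ j, ∑ n ∈ F, Vp n j * f n = ∑ n ∈ Ico B P, V n j * f n := by
    intro f j
    have h1 : ∑ n ∈ F, Vp n j * f n = ∑ n ∈ F, (if n < P then V n j * f n else 0) :=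
      Finset.sum_congr rfl fun n _ ↦ by
        simp only [hVp]
        split_ifs <;> simp
    rw [h1, ← Finset.sum_filter, Finset.Ico_filter_lt_of_le_right hPN]
  have hlamineq : 2 * ∑ j, lam j * ∑ m ∈ F, Vp m j * u m
        - ∑ j, ∑ j', lam j * lam j' * ∑ m ∈ F, Vp m j * Vp m j' / dhat m
      ≤ ∑ m ∈ F, dhat m * u m ^ 2 := by
    -- 0 ≤ Σ_m d_m (u_m − (Σ_j λ_j V'_{mj})/d_m)²
    have hpos : 0 ≤ ∑ m ∈ F, dhat m * (u m - (∑ j, lam j * Vp m j) / dhat m) ^ 2 :=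
      Finset.sum_nonneg fun m hm ↦ mul_nonneg (hd' m hm).le (sq_nonneg _)
    have hY : ∑ m ∈ F, (∑ j, lam j * Vp m j) * u m = ∑ j, lam j * ∑ m ∈ F, Vp m j * u m := by
      calc ∑ m ∈ F, (∑ j, lam j * Vp m j) * u m
          = ∑ m ∈ F, ∑ j, lam j * Vp m j * u m := Finset.sum_congr rfl fun m _ ↦ Finset.sum_mul _ _ _
        _ = ∑ j, ∑ m ∈ F, lam j * Vp m j * u m := Finset.sum_comm
        _ = ∑ j, lam j * ∑ m ∈ F, Vp m j * u m := Finset.sum_congr rfl fun j _ ↦ by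
              rw [Finset.mul_sum]
              exact Finset.sum_congr rfl fun m _ ↦ by ring
    have hZ : ∑ m ∈ F, (∑ j, lam j * Vp m j) ^ 2 / dhat m
        = ∑ j, ∑ j', lam j * lam j' * ∑ m ∈ F, Vp m j * Vp m j' / dhat m := by
      have e2 : ∀ m, (∑ j, lam j * Vp m j) ^ 2 / dhat m = ∑ j, ∑ j', lam j * lam j' * (Vp m j * Vp m j' / dhat m) := by
        intro m
        rw [sq, Finset.sum_mul_sum, Finset.sum_div]
        refine Finset.sum_congr rfl fun j _ ↦ ?_
        rw [Finset.sum_div]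
        exact Finset.sum_congr rfl fun j' _ ↦ by ring
      rw [Finset.sum_congr rfl fun m _ ↦ e2 m, Finset.sum_comm]
      refine Finset.sum_congr rfl fun j _ ↦ ?_
      rw [Finset.sum_comm]
      refine Finset.sum_congr rfl fun j' _ ↦ ?_
      rw [Finset.mul_sum]
    have e : ∑ m ∈ F, dhat m * (u m - (∑ j, lam j * Vp m j) / dhat m) ^ 2
        = ∑ m ∈ F, dhat m * u m ^ 2 - 2 * ∑ j, lam j * ∑ m ∈ F, Vp m j * u m
          + ∑ j, ∑ j', lam j * lam j' * ∑ m ∈ F, Vp m j * Vp m j' / dhat m := by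
      have e1 : ∀ m ∈ F, dhat m * (u m - (∑ j, lam j * Vp m j) / dhat m) ^ 2
          = dhat m * u m ^ 2 - 2 * ((∑ j, lam j * Vp m j) * u m) + (∑ j, lam j * Vp m j) ^ 2 / dhat m := by
        intro m hm
        have hdm := (hd' m hm).ne'
        field_simp
        ring
      rw [Finset.sum_congr rfl e1, Finset.sum_add_distrib, Finset.sum_sub_distrib, ← Finset.mul_sum, hY, hZ]
    rw [e] at hpos
    linarith
  -- identify Σ_m V' u = (Eβ)_j + η_j
  have hVu : ∀ j, ∑ m ∈ F, Vp m j * u m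
      = (β j - ∑ j', (∑ n ∈ Ico B P, V n j * V n j') * β j')
        + ∑ m ∈ Ico B P, V m j * g m / dhat m := by
    intro j
    have e1 : ∑ m ∈ F, Vp m j * u m = ∑ m ∈ F, Vp m j * y m - ∑ m ∈ F, Vp m j * v m + ∑ m ∈ F, Vp m j * (g m / dhat m) := by
      rw [← Finset.sum_sub_distrib, ← Finset.sum_add_distrib]
      exact Finset.sum_congr rfl fun m _ ↦ by simp only [hu, hw]; ring
    rw [e1, hVpsum y j, hVpsum v j, hVpsum (fun m ↦ g m / dhat m) j]
    have e2 : ∑ n ∈ Ico B P, V n j * y n = β j := by simp only [hβ]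
    have e3 : ∑ n ∈ Ico B P, V n j * v n = ∑ j', (∑ n ∈ Ico B P, V n j * V n j') * β j' := by
      have h1 : ∀ n ∈ Ico B P, V n j * v n = ∑ j', V n j * V n j' * β j' := by
        intro n hn
        have hnP : n < P := (Finset.mem_Ico.mp hn).2
        simp only [hv, if_pos hnP, hvP, Finset.mul_sum]
        exact Finset.sum_congr rfl fun j' _ ↦ by ring
      rw [Finset.sum_congr rfl h1, Finset.sum_comm]
      refine Finset.sum_congr rfl fun j' _ ↦ ?_
      rw [Finset.sum_mul]
    have e4 : ∑ m ∈ Ico B P, V m j * (g m / dhat m) = ∑ m ∈ Ico B P, V m j * g m / dhat m :=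
      Finset.sum_congr rfl fun m _ ↦ by ring
    rw [e2, e3, e4]
  have hVV : ∀ j j', ∑ m ∈ F, Vp m j * Vp m j' / dhat m = ∑ m ∈ Ico B P, V m j * V m j' / dhat m := by
    intro j j'
    have h1 : ∑ m ∈ F, Vp m j * Vp m j' / dhat m = ∑ m ∈ F, Vp m j * (Vp m j' / dhat m) :=
      Finset.sum_congr rfl fun m _ ↦ by ring
    rw [h1, hVpsum (fun m ↦ Vp m j' / dhat m) j]
    refine Finset.sum_congr rfl fun m hm ↦ ?_
    have hmP : m < P := (Finset.mem_Ico.mp hm).2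
    simp only [hVp, if_pos hmP]
    ring
  -- (6) assemble
  have hgsum : ∑ m ∈ F, g m ^ 2 / dhat m ≤ Uq x β := by
    have h := hU N x β
    simp only [hg, hc, hvP] at h ⊢
    exact h
  have hSx := hS x β
  -- the chain
  have step1 : 2 * ∑ m ∈ F, c m * w m + (2 * ∑ m ∈ F, (∑ n ∈ Ico B P, M n m * vP n) * w m
      + ∑ n ∈ F, ∑ m ∈ F, w n * M n m * w m) ≥ ∑ m ∈ F, dhat m * u m ^ 2 - ∑ m ∈ F, g m ^ 2 / dhat m := by
    have e1 : 2 * ∑ m ∈ F, c m * w m + 2 * ∑ m ∈ F, (∑ n ∈ Ico B P, M n m * vP n) * w m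
        = ∑ m ∈ F, 2 * g m * w m := by
      rw [Finset.mul_sum, Finset.mul_sum, ← Finset.sum_add_distrib]
      exact Finset.sum_congr rfl fun m _ ↦ by simp only [hg]; ring
    have e2 : ∑ m ∈ F, 2 * g m * w m + ∑ m ∈ F, dhat m * w m ^ 2
        = ∑ m ∈ F, dhat m * u m ^ 2 - ∑ m ∈ F, g m ^ 2 / dhat m := by
      rw [← Finset.sum_add_distrib, ← Finset.sum_sub_distrib]
      exact Finset.sum_congr rfl fun m hm ↦ hsq m hm
    have hfw' : ∑ m ∈ F, dhat m * w m ^ 2 ≤ ∑ n ∈ F, ∑ m ∈ F, w n * M n m * w m := hfw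
    linarith [e1, e2, hfw']
  have step2 : ∑ m ∈ F, dhat m * u m ^ 2
      ≥ 2 * ∑ j, lam j * ((β j - ∑ j', (∑ n ∈ Ico B P, V n j * V n j') * β j') + ∑ m ∈ Ico B P, V m j * g m / dhat m)
        - ∑ j, ∑ j', lam j * lam j' * ∑ m ∈ Ico B P, V m j * V m j' / dhat m := by
    have h := hlamineq
    simp only [hVu, hVV] at h
    linarith
  -- put together
  rw [hblock, hcoup, hfarsplit, hcv, hvMv]
  have hS' := hSx
  simp only [hg, hc, hvP, hlam] at step1 step2 hgsum hS' ⊢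
  nlinarith [step1, step2, hgsum, hS']

end Summit.RiemannHypothesis.RiemannHypothesis.Theorems.WeilFormatC
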